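import Mathlib
import HarnessLib
import Summits.FinalStateConjecture.Statement

/-!
# Route BurnettKineticRigidity — the Assembly re-typed for the T2 summit statement, frame form (item stmt-FinalStateConjecture-9991)

The assembly item of route `BurnettKineticRigidity` for the Final State Conjecture is

`SettlesOutsidePhotonRegions → PhotonRegionThresholdCodim → CensorshipViolationCodim → MGHDExistence →
FinalStateConjecture`

with A = `SettlesOutsidePhotonRegions` (censored dichotomy: every maximal vacuum Cauchy development of
an admissible datum with complete `𝓘⁺` either settles IN THE SUMMIT'S SENSE — exhaustive `C²`
decomposition into finitely many sub-extremal Kerrs plus radiation on `O = J⁺(Σ) ∩ I⁻(charted)`,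
every future-complete normalised null ray from the data staying in `closure O`
(`RaysStayInClosure`), honest growing near-zone radii (`HasExhaustiveCharts`) and future-oriented
chart time (`IsFutureOriented`) — or carries a photon-region remnant, a late chart on a Kerr
exterior `(M, a)`, `0 < M`, `|a| ≤ M`, on which the metric `C²`-converges on every annular slab
`{t* = τ, ρ ≤ r ≤ R}`), B_S = `PhotonRegionThresholdCodim` (through every admissible datum owning a
complete, remnant-carrying, non-settling MGHD passes, on ONE asymptotically flat end `e`, an
injective TAME (`IsTameDataFamily e 1`) admissible curve immersed at `0` (`IsImmersedAtZero 1`) all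
of whose other members have only complete MGHDs on which remnant ⇒ settles), B_W =
`CensorshipViolationCodim` (the same escape through every admissible datum owning an MGHD with
incomplete `𝓘⁺`) and S = `MGHDExistence` (Choquet-Bruhat–Geroch on the admissible class).

Re-typing (route rev 6, 2026-08-16T23:13:53Z, after the summit statement revision T2, p126844:
tame genericity on one fixed end, `RaysStayInClosure`, honest radii, `IsFutureOriented`): the three
cruxes were restated (stmt-FinalStateConjecture-17292/17293/17294 replacing 9987/9988/9989) and the
assembly item stmt-FinalStateConjecture-9991 — same text `A → B_S → B_W → S → FinalStateConjecture`,
new referents — reopened. The rev-5 frame theorem `BurnettKineticRigidity.assembly_proof` of the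
module `Theorems/BurnettKineticRigidityAssembly.lean` (p101300) stopped elaborating against the
revised `FinalStateConjecture` (full build 2026-08-16T23:32Z: type mismatches at the settled
conjunct and at the `AFEnd` witness); its landed STATEMENT — the rev-5 bodies as hypotheses, the
re-typed summit as conclusion — is obsolete and no longer follows by logic (none of the old cruxes
is refuted either), and Theorems files are append-only (p132225: `statement changed`; removal
bounces likewise), so that module is dead and flagged for operator removal (work item
`fix:…Theorems.BurnettKineticRigidityAssembly`). This module is the re-typed frame under a NEW name
(pattern `Theorems/PhotonSphereChannelsAssemblyFrameT2.lean`): same design, the four hypotheses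
re-inlined verbatim from the current route file (rev 8: the three cruxes as restated at rev 6,
`MGHDExistence` as restated 1:1 at rev 8 to the shared support item stmt-FinalStateConjecture-9937).

Design constraint (why this file does NOT import the route module
`Summits.FinalStateConjecture.FinalStateConjecture.Theses.BurnettKineticRigidity`): when an item
closes, the gate re-renders the route file with `import <closing module>` and
`theorem Assembly_holds : Assembly := …`; a closing module that itself imports the route module
turns that render into an import cycle (the EIHFluxBalance rev-3 and PhotonSphereChannels rev-3/4/6
episodes of this summit). So the theorem below states the four hypotheses INLINED VERBATIM (the
bodies of `SettlesOutsidePhotonRegions`, `PhotonRegionThresholdCodim`, `CensorshipViolationCodim`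
and `MGHDExistence`, copied from the route file rev 8, one physical line each, elaborated under the
route file's `open` lines), so that its type is the route decl
`Summit.FinalStateConjecture.FinalStateConjecture.Theses.BurnettKineticRigidity.Assembly` by
`δ`-unfolding alone, and the route file can import this module without a cycle (pattern of
`Theorems/EIHFluxBalanceAssemblyFrame.lean`, `Theorems/PhotonSphereChannelsAssemblyFrameR.lean`).

The proof is pure classical logic, the body of the route's deciding theorem `closes` (rev 6; crux-only
since rev 8): fix `X` and an admissible datum `d` failing the
conjecture's property `P`. By S an MGHD of `d` exists, so — `P d` failing — some MGHD of `d` has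
incomplete `𝓘⁺`, or every MGHD is complete and some complete MGHD does not settle. In the first
case B_W gives the end `e` and the escaping tame curve `F`; otherwise A gives a remnant on the
non-settling MGHD and B_S gives `e`, `F`. For `c ≠ 0`, `F c` is admissible, has an MGHD (S), and
every MGHD of it is complete with remnant ⇒ settles (escape clause) and settles ∨ remnant (A),
hence settles: `P (F c)`. So the exceptional set of `P` has tame Christodoulou codimension `≥ 1`
in the admissible class, which is `FinalStateConjecture`. No analysis, no new definitions; nothing
here bears on the truth of A, B_S, B_W or S (three open problems and the Choquet-Bruhat–Geroch
theorem).
-/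

-- `Summit.FinalStateConjecture.FinalStateConjecture.…`: summit = sub-problem name (D-0017), as in every file here;
-- the Summits library sets `weak.linter.dupNamespace = false`, repeated for standalone elaboration (`lean check`).
set_option linter.dupNamespace false

namespace Summit.FinalStateConjecture.FinalStateConjecture.Theorems

open scoped BigOperators Topology Manifold Classical MeasureTheory ProbabilityTheory Matrix InnerProductSpace ComplexConjugate ContinuousMap ContDiff
open Filter Set Function TopologicalSpace MeasureTheory

/-- **Assembly of route BurnettKineticRigidity re-typed for the T2 summit statement, frame form**
(item stmt-FinalStateConjecture-9991, route rev 8):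
`A → B_S → B_W → S → FinalStateConjecture` with A = `SettlesOutsidePhotonRegions` (censored
dichotomy: complete-`𝓘⁺` MGHDs of admissible data settle in the summit's sense — sub-extremal
exhaustive decomposition with `RaysStayInClosure`, honest radii, `IsFutureOriented` — or carry a
photon-region remnant), B_S = `PhotonRegionThresholdCodim` (escape, along an injective admissible
curve tame on one asymptotically flat end and immersed at `0`, from every datum owning a complete,
remnant-carrying, non-settling MGHD into data all of whose MGHDs are complete with
remnant ⇒ settles), B_W = `CensorshipViolationCodim` (the same escape from every datum owning an
MGHD with incomplete `𝓘⁺`) and S = `MGHDExistence` (every admissible vacuum datum has an MGHD), all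
four written out verbatim so that this type unfolds to the route decl
`Summit.FinalStateConjecture.FinalStateConjecture.Theses.BurnettKineticRigidity.Assembly` by
`δ`-reduction alone. Proof (classical logic, the route's deciding theorem `closes`): an exceptional
admissible datum has an MGHD (S), hence is censorship-violating or — by A — photon-region-threshold;
B_W resp. B_S supply the end and the tame Christodoulou curve, whose members off `c = 0` satisfy the
conjecture's property by S, the escape clause and A again. [cite: Christodoulou1999, p. A24]
[cite: DafermosLuk2017, Conjecture 1] -/
theorem BurnettKineticRigidity.assemblyT2_frame_proof :
    (∀ (X : Type) [TopologicalSpace X] [ChartedSpace Literature.Geometry.Lorentzian.E3 X] [IsManifold (𝓡 3) ∞ X] [T2Space X] [SecondCountableTopology X] [ConnectedSpace X], ∀ D ∈ Literature.Geometry.Lorentzian.admissibleVacuumData X, ∀ 𝒟 : Literature.Geometry.Lorentzian.VacuumCauchyDevelopment D, 𝒟.IsMaximal → Summit.FinalStateConjecture.HasCompleteNullInfinity 𝒟.toCauchyDevelopment → (∃ (O : Set 𝒟.carrier) (d : Literature.Geometry.Lorentzian.FinalStateDecomposition 𝒟.toSpacetime O 2), (∀ i, Literature.Geometry.Lorentzian.Kerr.IsSubextremal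 (d.mass i) (d.spin i)) ∧ O = Summit.FinalStateConjecture.exteriorOf 𝒟.toCauchyDevelopment d.charted ∧ Summit.FinalStateConjecture.RaysStayInClosure 𝒟.toCauchyDevelopment O ∧ Summit.FinalStateConjecture.HasExhaustiveCharts d ∧ Summit.FinalStateConjecture.IsFutureOriented d) ∨ (∃ (M a ρ τ₀ : ℝ) (Ψ : ↥(Literature.Geometry.Lorentzian.Kerr.background M a).domain → 𝒟.carrier), 0 < M ∧ |a| ≤ M ∧ 𝒟.toSpacetime.IsLateChart (Literature.Geometry.Lorentzian.Kerr.background M a) (𝒟.metric.causalFuture 𝒟.timeOrientation (Set.range 𝒟.embed)) τ₀ Ψ ∧ ∀ R : ℝ, Filter.Tendsto (fun τ : ℝ ↦ Literature.Geometry.Lorentzian.supCkENorm (Subtype.val '' {x : ↥(Literature.Geometry.Lorentzian.Kerr.background M a).domain | (x : Literature.Geometry.Lorentzian.E4) 0 = τ ∧ ρ ≤ Literature.Geometry.Lorentzian.Kerr.radius a x ∧ Literature.Geometry.Lorentzian.Kerr.radius a x ≤ R}) 2 (𝒟.toSpacetime.deviationExtend (Literature.Geometry.Lorentzian.Kerr.background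 M a) Ψ)) Filter.atTop (nhds 0))) →
    (∀ (X : Type) [TopologicalSpace X] [ChartedSpace Literature.Geometry.Lorentzian.E3 X] [IsManifold (𝓡 3) ∞ X] [T2Space X] [SecondCountableTopology X] [ConnectedSpace X], ∀ D ∈ Literature.Geometry.Lorentzian.admissibleVacuumData X, (∃ 𝒟 : Literature.Geometry.Lorentzian.VacuumCauchyDevelopment D, 𝒟.IsMaximal ∧ Summit.FinalStateConjecture.HasCompleteNullInfinity 𝒟.toCauchyDevelopment ∧ (∃ (M a ρ τ₀ : ℝ) (Ψ : ↥(Literature.Geometry.Lorentzian.Kerr.background M a).domain → 𝒟.carrier), 0 < M ∧ |a| ≤ M ∧ 𝒟.toSpacetime.IsLateChart (Literature.Geometry.Lorentzian.Kerr.background M a) (𝒟.metric.causalFuture 𝒟.timeOrientation (Set.range 𝒟.embed)) τ₀ Ψ ∧ ∀ R : ℝ, Filter.Tendsto (fun τ : ℝ ↦ Literature.Geometry.Lorentzian.supCkENorm (Subtype.val '' {x : ↥(Literature.Geometry.Lorentzian.Kerr.background M a).domain | (x : Literature.Geometry.Lorentzian.E4) 0 = τ ∧ ρ ≤ Literature.Geometry.Lorentzian.Kerr.radius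 a x ∧ Literature.Geometry.Lorentzian.Kerr.radius a x ≤ R}) 2 (𝒟.toSpacetime.deviationExtend (Literature.Geometry.Lorentzian.Kerr.background M a) Ψ)) Filter.atTop (nhds 0)) ∧ ¬ (∃ (O : Set 𝒟.carrier) (d : Literature.Geometry.Lorentzian.FinalStateDecomposition 𝒟.toSpacetime O 2), (∀ i, Literature.Geometry.Lorentzian.Kerr.IsSubextremal (d.mass i) (d.spin i)) ∧ O = Summit.FinalStateConjecture.exteriorOf 𝒟.toCauchyDevelopment d.charted ∧ Summit.FinalStateConjecture.RaysStayInClosure 𝒟.toCauchyDevelopment O ∧ Summit.FinalStateConjecture.HasExhaustiveCharts d ∧ Summit.FinalStateConjecture.IsFutureOriented d)) → ∃ (e : Literature.Geometry.Lorentzian.AFEnd X) (F : EuclideanSpace ℝ (Fin 1) → Literature.Geometry.Lorentzian.InitialDataSet (𝓡 3) X), Literature.Geometry.Lorentzian.InitialDataSet.IsTameDataFamily e 1 F ∧ Literature.Geometry.Lorentzian.InitialDataSet.IsImmersedAtZero 1 F ∧ F 0 = D ∧ Function.Injective F ∧ (∀ c, F c ∈ Literature.Geometry.Lorentzian.admissibleVacuumData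 X) ∧ ∀ c ≠ 0, ∀ 𝒟 : Literature.Geometry.Lorentzian.VacuumCauchyDevelopment (F c), 𝒟.IsMaximal → Summit.FinalStateConjecture.HasCompleteNullInfinity 𝒟.toCauchyDevelopment ∧ ((∃ (M a ρ τ₀ : ℝ) (Ψ : ↥(Literature.Geometry.Lorentzian.Kerr.background M a).domain → 𝒟.carrier), 0 < M ∧ |a| ≤ M ∧ 𝒟.toSpacetime.IsLateChart (Literature.Geometry.Lorentzian.Kerr.background M a) (𝒟.metric.causalFuture 𝒟.timeOrientation (Set.range 𝒟.embed)) τ₀ Ψ ∧ ∀ R : ℝ, Filter.Tendsto (fun τ : ℝ ↦ Literature.Geometry.Lorentzian.supCkENorm (Subtype.val '' {x : ↥(Literature.Geometry.Lorentzian.Kerr.background M a).domain | (x : Literature.Geometry.Lorentzian.E4) 0 = τ ∧ ρ ≤ Literature.Geometry.Lorentzian.Kerr.radius a x ∧ Literature.Geometry.Lorentzian.Kerr.radius a x ≤ R}) 2 (𝒟.toSpacetime.deviationExtend (Literature.Geometry.Lorentzian.Kerr.background M a) Ψ)) Filter.atTop (nhds 0)) → (∃ (O : Set 𝒟.carrier)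 (d : Literature.Geometry.Lorentzian.FinalStateDecomposition 𝒟.toSpacetime O 2), (∀ i, Literature.Geometry.Lorentzian.Kerr.IsSubextremal (d.mass i) (d.spin i)) ∧ O = Summit.FinalStateConjecture.exteriorOf 𝒟.toCauchyDevelopment d.charted ∧ Summit.FinalStateConjecture.RaysStayInClosure 𝒟.toCauchyDevelopment O ∧ Summit.FinalStateConjecture.HasExhaustiveCharts d ∧ Summit.FinalStateConjecture.IsFutureOriented d))) →
    (∀ (X : Type) [TopologicalSpace X] [ChartedSpace Literature.Geometry.Lorentzian.E3 X] [IsManifold (𝓡 3) ∞ X] [T2Space X] [SecondCountableTopology X] [ConnectedSpace X], ∀ D ∈ Literature.Geometry.Lorentzian.admissibleVacuumData X, (∃ 𝒟 : Literature.Geometry.Lorentzian.VacuumCauchyDevelopment D, 𝒟.IsMaximal ∧ ¬ Summit.FinalStateConjecture.HasCompleteNullInfinity 𝒟.toCauchyDevelopment) → ∃ (e : Literature.Geometry.Lorentzian.AFEnd X) (F : EuclideanSpace ℝ (Fin 1) → Literature.Geometry.Lorentzian.InitialDataSet (𝓡 3) X), Literature.Geometry.Lorentzian.InitialDataSet.IsTameDataFamily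 e 1 F ∧ Literature.Geometry.Lorentzian.InitialDataSet.IsImmersedAtZero 1 F ∧ F 0 = D ∧ Function.Injective F ∧ (∀ c, F c ∈ Literature.Geometry.Lorentzian.admissibleVacuumData X) ∧ ∀ c ≠ 0, ∀ 𝒟 : Literature.Geometry.Lorentzian.VacuumCauchyDevelopment (F c), 𝒟.IsMaximal → Summit.FinalStateConjecture.HasCompleteNullInfinity 𝒟.toCauchyDevelopment ∧ ((∃ (M a ρ τ₀ : ℝ) (Ψ : ↥(Literature.Geometry.Lorentzian.Kerr.background M a).domain → 𝒟.carrier), 0 < M ∧ |a| ≤ M ∧ 𝒟.toSpacetime.IsLateChart (Literature.Geometry.Lorentzian.Kerr.background M a) (𝒟.metric.causalFuture 𝒟.timeOrientation (Set.range 𝒟.embed)) τ₀ Ψ ∧ ∀ R : ℝ, Filter.Tendsto (fun τ : ℝ ↦ Literature.Geometry.Lorentzian.supCkENorm (Subtype.val '' {x : ↥(Literature.Geometry.Lorentzian.Kerr.background M a).domain | (x : Literature.Geometry.Lorentzian.E4) 0 = τ ∧ ρ ≤ Literature.Geometry.Lorentzian.Kerr.radius a x ∧ Literature.Geometry.Lorentzian.Kerr.radius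 a x ≤ R}) 2 (𝒟.toSpacetime.deviationExtend (Literature.Geometry.Lorentzian.Kerr.background M a) Ψ)) Filter.atTop (nhds 0)) → (∃ (O : Set 𝒟.carrier) (d : Literature.Geometry.Lorentzian.FinalStateDecomposition 𝒟.toSpacetime O 2), (∀ i, Literature.Geometry.Lorentzian.Kerr.IsSubextremal (d.mass i) (d.spin i)) ∧ O = Summit.FinalStateConjecture.exteriorOf 𝒟.toCauchyDevelopment d.charted ∧ Summit.FinalStateConjecture.RaysStayInClosure 𝒟.toCauchyDevelopment O ∧ Summit.FinalStateConjecture.HasExhaustiveCharts d ∧ Summit.FinalStateConjecture.IsFutureOriented d))) →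
    (∀ (X : Type) [TopologicalSpace X] [ChartedSpace Literature.Geometry.Lorentzian.E3 X] [IsManifold (𝓡 3) ((⊤ : ℕ∞) : WithTop ℕ∞) X] [T2Space X] [SecondCountableTopology X] [ConnectedSpace X], ∀ D ∈ Literature.Geometry.Lorentzian.admissibleVacuumData X, ∃ 𝒟 : Literature.Geometry.Lorentzian.VacuumCauchyDevelopment D, 𝒟.IsMaximal) →
    _root_.FinalStateConjecture := by
  intro hA hS hW hE X _ _ _ _ _ _ d hd
  obtain ⟨hdA, hnP⟩ := hd
  -- an escaping TAME family exists (re-type T2: one fixed end `e`, immersed at `0`)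
  have hesc : ∃ (e : Literature.Geometry.Lorentzian.AFEnd X) (F : EuclideanSpace ℝ (Fin 1) → Literature.Geometry.Lorentzian.InitialDataSet (𝓡 3) X), Literature.Geometry.Lorentzian.InitialDataSet.IsTameDataFamily e 1 F ∧ Literature.Geometry.Lorentzian.InitialDataSet.IsImmersedAtZero 1 F ∧ F 0 = d ∧ Function.Injective F ∧ (∀ c, F c ∈ Literature.Geometry.Lorentzian.admissibleVacuumData X) ∧ ∀ c ≠ 0, ∀ 𝒟 : Literature.Geometry.Lorentzian.VacuumCauchyDevelopment (F c), 𝒟.IsMaximal → Summit.FinalStateConjecture.HasCompleteNullInfinity 𝒟.toCauchyDevelopment ∧ ((∃ (M a ρ τ₀ : ℝ) (Ψ : ↥(Literature.Geometry.Lorentzian.Kerr.background M a).domain → 𝒟.carrier), 0 < M ∧ |a| ≤ M ∧ 𝒟.toSpacetime.IsLateChart (Literature.Geometry.Lorentzian.Kerr.background M a) (𝒟.metric.causalFuture 𝒟.timeOrientation (Set.range 𝒟.embed)) τ₀ Ψ ∧ ∀ R : ℝ, Filter.Tendsto (fun τ : ℝ ↦ Literature.Geometry.Lorentzian.supCkENorm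 (Subtype.val '' {x : ↥(Literature.Geometry.Lorentzian.Kerr.background M a).domain | (x : Literature.Geometry.Lorentzian.E4) 0 = τ ∧ ρ ≤ Literature.Geometry.Lorentzian.Kerr.radius a x ∧ Literature.Geometry.Lorentzian.Kerr.radius a x ≤ R}) 2 (𝒟.toSpacetime.deviationExtend (Literature.Geometry.Lorentzian.Kerr.background M a) Ψ)) Filter.atTop (nhds 0)) → (∃ (O : Set 𝒟.carrier) (d : Literature.Geometry.Lorentzian.FinalStateDecomposition 𝒟.toSpacetime O 2), (∀ i, Literature.Geometry.Lorentzian.Kerr.IsSubextremal (d.mass i) (d.spin i)) ∧ O = Summit.FinalStateConjecture.exteriorOf 𝒟.toCauchyDevelopment d.charted ∧ Summit.FinalStateConjecture.RaysStayInClosure 𝒟.toCauchyDevelopment O ∧ Summit.FinalStateConjecture.HasExhaustiveCharts d ∧ Summit.FinalStateConjecture.IsFutureOriented d)) := by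
    by_cases hc : ∃ 𝒟 : Literature.Geometry.Lorentzian.VacuumCauchyDevelopment d, 𝒟.IsMaximal ∧
        ¬ Summit.FinalStateConjecture.HasCompleteNullInfinity 𝒟.toCauchyDevelopment
    · -- a censorship-violating datum: B_W
      exact hW X d hdA hc
    · -- every MGHD is censored; `d` being exceptional, some MGHD does not settle, and A puts a
      -- photon-region remnant on it: B_S
      have hc' : ∀ 𝒟 : Literature.Geometry.Lorentzian.VacuumCauchyDevelopment d, 𝒟.IsMaximal →
          Summit.FinalStateConjecture.HasCompleteNullInfinity 𝒟.toCauchyDevelopment := by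
        intro 𝒟 h𝒟
        by_contra hn
        exact hc ⟨𝒟, h𝒟, hn⟩
      apply hS X d hdA
      by_contra hno
      apply hnP
      refine ⟨hE X d hdA, fun 𝒟 h𝒟 ↦ ⟨hc' 𝒟 h𝒟, ?_⟩⟩
      rcases hA X d hdA 𝒟 h𝒟 (hc' 𝒟 h𝒟) with hset | hrem
      · exact hset
      · by_contra hns
        exact hno ⟨𝒟, h𝒟, hc' 𝒟 h𝒟, hrem, hns⟩
  obtain ⟨e, F, hF, hI, h0, hinj, hadm, hgood⟩ := hesc
  -- the same end and family escape the exceptional set of the conjecture's property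
  refine ⟨e, F, hF, hI, h0, hinj, hadm, fun c hc hmem ↦ ?_⟩
  obtain ⟨-, hnP'⟩ := hmem
  apply hnP'
  refine ⟨hE X (F c) (hadm c), fun 𝒟 h𝒟 ↦ ?_⟩
  obtain ⟨hcomp, himp⟩ := hgood c hc 𝒟 h𝒟
  refine ⟨hcomp, ?_⟩
  rcases hA X (F c) (hadm c) 𝒟 h𝒟 hcomp with hset | hrem
  · exact hset
  · exact himp hrem

end Summit.FinalStateConjecture.FinalStateConjecture.Theorems
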